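import Summits.AtomisticToContinuum.BoseEinsteinCondensation.Statement
import Literature.MathematicalPhysics.QuantumManyBody.BoseEinsteinCondensation
import Mathlib.MeasureTheory.Measure.Haar.InnerProductSpace

/-!
# Route `BECThomsonPrinciple`, crux `PeriodicToDirichlet` (stmt-AtomisticToContinuum-9483),
# line `Sketch` (torus-in-the-box-doob): registered stub `stub_innerFlatToBEC`

The closing glue of the line: if, for every repulsive finite-range `v` and every small density,
all `δ`-near-minimisers of the Dirichlet energy in the box of side `L_N = (N/ρ)^{1/3}` occupy the
normalised flat mode of the INNER cube `(θL_N, L_N - θL_N)³` macroscopically (`≥ cN`, some fixed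
`θ ∈ (0,1/2)`), then the conjunct `BoseEinsteinCondensation` holds — the inner flat mode is a
normalised measurable one-body mode, so its occupation bounds `λ_max(γ)`
(`occupation_le_maxOccupation`), and the uniform bound over near-minimisers bounds
`condensateNumber` (`le_condensateNumber`). Pattern of
`AtomisticToContinuum.BECInfraredBound.bec_of_zeroMode` (box flat mode). No definitions: the inner
cube and its flat mode are written as explicit set-builder / indicator terms (the registered stub
signature is the unfolded statement). [folklore]
-/

noncomputable section

open MeasureTheory Filter
open scoped ENNReal NNReal

namespace Summit.AtomisticToContinuum.BoseEinsteinCondensation.TorusInTheBox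

open Literature.MathematicalPhysics.QuantumManyBody.BoseGas

/-- The inner cube `(θL, L-θL)³` is measurable (finite intersection of coordinate slabs). [folklore] -/
theorem measurableSet_innerCube (θ L : ℝ) :
    MeasurableSet {x : Space | ∀ t, x t ∈ Set.Ioo (θ * L) (L - θ * L)} := by
  have : {x : Space | ∀ t, x t ∈ Set.Ioo (θ * L) (L - θ * L)} =
      ⋂ t : Fin 3, (fun x : Space => x t) ⁻¹' Set.Ioo (θ * L) (L - θ * L) := by
    ext x; simp
  rw [this]
  exact MeasurableSet.iInter fun t => measurableSet_Ioo.preimage (by fun_prop)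

/-- `|(θL, L-θL)³| = (ofReal ((1-2θ)L))³` (junk value `0` when `(1-2θ)L ≤ 0`). [folklore] -/
theorem volume_innerCube (θ L : ℝ) :
    volume {x : Space | ∀ t, x t ∈ Set.Ioo (θ * L) (L - θ * L)} =
      ENNReal.ofReal ((1 - 2 * θ) * L) ^ 3 := by
  have e : {x : Space | ∀ t, x t ∈ Set.Ioo (θ * L) (L - θ * L)} =
      (@WithLp.ofLp 2 (Fin 3 → ℝ)) ⁻¹' (Set.univ.pi fun _ => Set.Ioo (θ * L) (L - θ * L)) := by
    ext x; simp
  rw [e, (PiLp.volume_preserving_ofLp (Fin 3)).measure_preimage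
    (MeasurableSet.univ_pi fun _ => measurableSet_Ioo).nullMeasurableSet, volume_pi_pi]
  simp only [Real.volume_Ioo, Finset.prod_const, Finset.card_univ, Fintype.card_fin]
  congr 1
  congr 1
  ring

/-- The inner flat mode is a.e.-strongly measurable. [folklore] -/
theorem aestronglyMeasurable_innerFlatMode (θ L : ℝ) :
    AEStronglyMeasurable
      (Set.indicator {x : Space | ∀ t, x t ∈ Set.Ioo (θ * L) (L - θ * L)}
        (fun _ => ((Real.sqrt (((1 - 2 * θ) * L) ^ 3))⁻¹ : ℂ))) volume :=
  aestronglyMeasurable_const.indicator (measurableSet_innerCube θ L)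

/-- The inner flat mode is `L²`-normalised when `(1-2θ)L > 0`. [folklore] -/
theorem lintegral_innerFlatMode_sq {θ L : ℝ} (h : 0 < (1 - 2 * θ) * L) :
    ∫⁻ x, (‖Set.indicator {x : Space | ∀ t, x t ∈ Set.Ioo (θ * L) (L - θ * L)}
        (fun _ => ((Real.sqrt (((1 - 2 * θ) * L) ^ 3))⁻¹ : ℂ)) x‖₊ : ℝ≥0∞) ^ 2 = 1 := by
  set C : Set Space := {x : Space | ∀ t, x t ∈ Set.Ioo (θ * L) (L - θ * L)} with hC
  set M : ℝ := (1 - 2 * θ) * L with hM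
  have hM3 : 0 ≤ M ^ 3 := by positivity
  have h1 : (fun x => (‖C.indicator (fun _ => ((Real.sqrt (M ^ 3))⁻¹ : ℂ)) x‖₊ : ℝ≥0∞) ^ 2) =
      C.indicator (fun _ => ENNReal.ofReal ((M ^ 3)⁻¹)) := by
    funext x
    by_cases hx : x ∈ C
    · simp only [Set.indicator_of_mem hx]
      rw [← ENNReal.coe_pow, ENNReal.ofReal, ENNReal.coe_inj]
      ext
      rw [NNReal.coe_pow, coe_nnnorm, norm_inv, Complex.norm_real,
        Real.norm_of_nonneg (Real.sqrt_nonneg _), inv_pow, Real.sq_sqrt hM3,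
        Real.coe_toNNReal _ (by positivity)]
    · simp [hx]
  rw [h1, lintegral_indicator (measurableSet_innerCube θ L), setLIntegral_const,
    volume_innerCube, ← ENNReal.ofReal_pow h.le, ← ENNReal.ofReal_mul (by positivity),
    inv_mul_cancel₀ (by positivity), ENNReal.ofReal_one]

/-- **Registered stub `stub_innerFlatToBEC`** (line `Sketch` of crux stmt-AtomisticToContinuum-9483;
the skeleton's `InnerFlatToBEC`, unfolded): inner flat-mode occupation `≥ cN` of all
`δ`-near-minimisers, eventually in `N`, for some `θ ∈ (0,1/2)`, implies the conjunct. For `N ≥ 1`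
the side `L_N = (N/ρ)^{1/3}` is positive, so the inner flat mode is a normalised measurable one-body
mode; `occupation_le_maxOccupation` and `le_condensateNumber` conclude. [folklore] -/
theorem stub_innerFlatToBEC :
    (∀ v : ℝ → ℝ≥0∞, IsRepulsiveFiniteRange v → ∃ ρ₀ : ℝ, 0 < ρ₀ ∧ ∀ ρ : ℝ, 0 < ρ → ρ < ρ₀ →
      ∃ θ : ℝ, 0 < θ ∧ θ < 1 / 2 ∧ ∃ c : ℝ, 0 < c ∧ ∀ᶠ N : ℕ in atTop, ∃ δ : ℝ≥0∞, 0 < δ ∧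
        ∀ Ψ : TrialState N (sideLength ρ N),
          energy v Ψ ≤ groundStateEnergy v N (sideLength ρ N) + δ →
            ENNReal.ofReal (c * N) ≤ occupation N
              (Set.indicator {x : Space | ∀ t, x t ∈ Set.Ioo (θ * sideLength ρ N)
                  (sideLength ρ N - θ * sideLength ρ N)}
                (fun _ => ((Real.sqrt (((1 - 2 * θ) * sideLength ρ N) ^ 3))⁻¹ : ℂ))) Ψ.ψ) →
    _root_.BoseEinsteinCondensation := by
  intro h v hv
  obtain ⟨ρ₀, hρ₀, H⟩ := h v hv
  refine ⟨ρ₀, hρ₀, fun ρ hρ hρlt => ?_⟩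
  obtain ⟨θ, _hθ, hθhalf, c, hc, hev⟩ := H ρ hρ hρlt
  refine ⟨c, hc, ?_⟩
  filter_upwards [hev, eventually_gt_atTop 0] with N hN hNpos
  obtain ⟨δ, hδ, hΨ⟩ := hN
  have hL : 0 < sideLength ρ N := by
    unfold sideLength
    exact Real.rpow_pos_of_pos (div_pos (Nat.cast_pos.mpr hNpos) hρ) _
  have hM : 0 < (1 - 2 * θ) * sideLength ρ N := mul_pos (by linarith) hL
  exact le_condensateNumber v hδ fun Ψ hE =>
    (hΨ Ψ hE).trans (occupation_le_maxOccupation _ (aestronglyMeasurable_innerFlatMode _ _)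
      (lintegral_innerFlatMode_sq hM))

end Summit.AtomisticToContinuum.BoseEinsteinCondensation.TorusInTheBox

end
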